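import Literature.NumberTheory.Sieve.DrappeauTypeIReductionGPart
import HarnessLib

/-!
# Drappeau's kernel `𝔲_R` against smooth variables, IV: the Type I bound

Topic `Literature/NumberTheory/Sieve`; theorems only, everything PROVED.  Fourth file of the treatment of the
Type I sums of S. Drappeau, PLMS 114 (2017) §6.2 (arXiv:1504.05549, p. 22), assembling the previous three
(`DrappeauTypeIReduction`, `…Boxes`, `…GPart`): for `k + 1` smooth variables `m⃗ = (mᵢ)_{i<k}`, `n` in dyadic boxes
and unit classes `mod L`, cut by the hyperbola `ν (∏mᵢ) n ≤ Y`, and a set `𝒮` of moduli `s ≤ x_F^θ` coprime to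
`cL`,

`∑_{s ∈ 𝒮} |∑_{m⃗, n} 𝔲_{Rd}(ν (∏mᵢ) n c̄; s)| ≤ H^k C L^{C₀} x_F^{1−δ} Φ + (kY/(νH) + ∏ 2Vᵢ)(Dv + Φ) + Rd² (∏ 2Vᵢ) Ψ`

(`typeI_uR_bound`; `Φ = ∑_s φ(s)⁻¹`, `Ψ = ∑_s τ(s)²/φ(s)`, `Dv` a bound for `#{s ∈ 𝒮 : s ∣ z}`), where
`(δ, C₀, C)` are the constants of the divisor-function input (the body of `FouvryTenenbaum2021.DivisorAPTuple k θ`,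
Fouvry–Tenenbaum's Lemmas 4.12–4.13 in tuple form, hypothesis `hFT`).  The moduli `s` not coprime to `ν` contribute
nothing (`𝔲_R` vanishes at non-units); for the others `𝔲_R = g_s − φ⁻¹ ∑_ψ ψ̄ψ` (`uR_natCast_mul_eq`), the
`g_s`-part is `sum_abs_gAPpart_le` and the characters are `norm_charPart_total_le`.

* `sum_sum_mul_sum_comm` — a rearrangement of finite sums;
* `windowSum_uR_eq_zero`, `windowSum_uR_eq`, `norm_windowSum_uR_le` — one modulus;
* `typeI_uR_bound` — the bound above; `typeI_uR_bound_of_divisorAPTuple` — the same from `DivisorAPTuple k θ`.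

## References

* S. Drappeau, Proc. London Math. Soc. (3) 114 (2017) 684–732, §5 (5.1)–(5.2), §6.2. [Drappeau2017]
* É. Fouvry, G. Tenenbaum, Trans. Amer. Math. Soc. 375 (2022), Lemmas 4.12–4.13. [FouvryTenenbaum2021]
-/

open Finset Fintype Real
open scoped ArithmeticFunction.sigma Classical

noncomputable section

namespace Literature.NumberTheory.Sieve

namespace DrappeauTypeI

open Drappeau2017 FouvryTenenbaum2021

/-! ### One modulus -/

/-- `∑_m ∑_n a (∑_ψ w_ψ T_ψ(m, n)) = a ∑_ψ w_ψ ∑_m ∑_n T_ψ(m, n)`. [folklore] -/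
theorem sum_sum_mul_sum_comm {α β γ : Type*} (B : Finset β) (A : Finset α) (X : Finset γ) (a : ℂ)
    (w : γ → ℂ) (T : γ → β → α → ℂ) :
    ∑ m ∈ B, ∑ n ∈ A, (a * ∑ ψ ∈ X, w ψ * T ψ m n) = a * ∑ ψ ∈ X, (w ψ * ∑ m ∈ B, ∑ n ∈ A, T ψ m n) := by
  have h1 : ∀ m ∈ B, ∑ n ∈ A, (a * ∑ ψ ∈ X, w ψ * T ψ m n) = ∑ n ∈ A, ∑ ψ ∈ X, a * (w ψ * T ψ m n) :=
    fun m _ => Finset.sum_congr rfl fun n _ => Finset.mul_sum _ _ _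
  have h2 : a * ∑ ψ ∈ X, (w ψ * ∑ m ∈ B, ∑ n ∈ A, T ψ m n) = ∑ ψ ∈ X, ∑ m ∈ B, ∑ n ∈ A, a * (w ψ * T ψ m n) := by
    rw [Finset.mul_sum]
    refine Finset.sum_congr rfl fun ψ _ => ?_
    rw [Finset.mul_sum, Finset.mul_sum]
    refine Finset.sum_congr rfl fun m _ => ?_
    rw [Finset.mul_sum, Finset.mul_sum]
  rw [Finset.sum_congr rfl h1, h2]
  calc ∑ m ∈ B, ∑ n ∈ A, ∑ ψ ∈ X, a * (w ψ * T ψ m n)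
      = ∑ m ∈ B, ∑ ψ ∈ X, ∑ n ∈ A, a * (w ψ * T ψ m n) := Finset.sum_congr rfl fun m _ => Finset.sum_comm
    _ = ∑ ψ ∈ X, ∑ m ∈ B, ∑ n ∈ A, a * (w ψ * T ψ m n) := Finset.sum_comm

/-- Moduli not coprime to `ν` contribute nothing: `𝔲_R(ν t c̄; s) = 0` termwise. [cite: Drappeau2017, §5 (5.1)] -/
theorem windowSum_uR_eq_zero {s ν : ℕ} (hν : ¬ ν.Coprime s) {k : ℕ} (B : Finset (Fin k → ℕ)) (A : Finset ℕ)
    (W : (Fin k → ℕ) → ℕ → Prop) (Rd : ℝ) (c : ℤ) :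
    ∑ m ∈ B, ∑ n ∈ A, (if W m n then
        uR Rd s ((((ν * ((∏ i, m i) * n)) : ℕ) : ZMod s) * ((c : ZMod s))⁻¹) else 0) = 0 := by
  refine Finset.sum_eq_zero fun m _ => Finset.sum_eq_zero fun n _ => ?_
  rw [uR_eq_zero_of_not_isUnit, ite_self]
  intro hu
  apply hν
  rw [← ZMod.isUnit_iff_coprime]
  have h1 := isUnit_of_mul_isUnit_left hu
  rw [Nat.cast_mul] at h1
  exact isUnit_of_mul_isUnit_left h1

/-- **One modulus, decomposed**: for `(s, cν) = 1`, `Rd ≥ 1`, the windowed double sum of `𝔲_{Rd}(ν(∏mᵢ)n c̄; s)`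
is the `g_s`-sum minus `φ(s)⁻¹ ∑_{ψ ≠ ψ₀, cond ψ ≤ Rd} ψ(ν c̄) (windowed double sum of ψ((∏mᵢ)n))`.
[cite: Drappeau2017, §5 (5.1)] -/
theorem windowSum_uR_eq {s : ℕ} [NeZero s] {Rd : ℝ} (hRd : 1 ≤ Rd) {c : ℤ} {ν : ℕ} (hc : IsCoprime (s : ℤ) c)
    (hν : ν.Coprime s) {k : ℕ} (B : Finset (Fin k → ℕ)) (A : Finset ℕ) (W : (Fin k → ℕ) → ℕ → Prop) :
    ∑ m ∈ B, ∑ n ∈ A, (if W m n then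
        uR Rd s ((((ν * ((∏ i, m i) * n)) : ℕ) : ZMod s) * ((c : ZMod s))⁻¹) else 0) =
      ((∑ m ∈ B, ∑ n ∈ A, (if W m n then gAP s (aRep s c ν) ((∏ i, m i) * n) else 0) : ℝ) : ℂ) -
        ((Nat.totient s : ℂ))⁻¹ *
          ∑ ψ ∈ (univ : Finset (DirichletCharacter ℂ s)).filter (fun ψ => ψ ≠ 1 ∧ (ψ.conductor : ℝ) ≤ Rd),
            ψ ((ν : ZMod s) * ((c : ZMod s))⁻¹) *
              ∑ m ∈ B, ∑ n ∈ A, (if W m n then ψ ((((∏ i, m i) * n : ℕ)) : ZMod s) else 0) := by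
  -- termwise
  have h1 : ∀ m n, (if W m n then uR Rd s ((((ν * ((∏ i, m i) * n)) : ℕ) : ZMod s) * ((c : ZMod s))⁻¹)
      else 0) = ((if W m n then gAP s (aRep s c ν) ((∏ i, m i) * n) else 0 : ℝ) : ℂ) -
      ((Nat.totient s : ℂ))⁻¹ *
        ∑ ψ ∈ (univ : Finset (DirichletCharacter ℂ s)).filter (fun ψ => ψ ≠ 1 ∧ (ψ.conductor : ℝ) ≤ Rd),
          ψ ((ν : ZMod s) * ((c : ZMod s))⁻¹) * (if W m n then ψ ((((∏ i, m i) * n : ℕ)) : ZMod s) else 0) := by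
    intro m n
    by_cases hw : W m n
    · simp only [if_pos hw]
      exact uR_natCast_mul_eq hRd hc hν _
    · simp only [if_neg hw, mul_zero, Finset.sum_const_zero, Complex.ofReal_zero, sub_zero]
  simp_rw [h1]
  rw [Finset.sum_congr rfl fun m _ => Finset.sum_sub_distrib _ _, Finset.sum_sub_distrib]
  congr 1
  · push_cast
    rfl
  · exact sum_sum_mul_sum_comm B A _ _ _ _

/-- **One modulus, bounded**: for `(s, cν) = 1`, `(L, s) = 1`, `Rd ≥ 1`, initial tuples in a finite set `B` and
the last variable in `apBox lo hi L tl`: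
`‖∑_{m⃗, n} [window] 𝔲_{Rd}(ν(∏mᵢ)n c̄; s)‖ ≤ |∑_{m⃗, n} [window] g_s((∏mᵢ)n; cν̄)| + Rd² #B τ(s)²/φ(s)`.
[cite: Drappeau2017, §6.2] -/
theorem norm_windowSum_uR_le {s : ℕ} [NeZero s] {Rd : ℝ} (hRd : 1 ≤ Rd) {c : ℤ} {ν : ℕ} (hc : IsCoprime (s : ℤ) c)
    (hν : ν.Coprime s) {L : ℕ} (hL : 0 < L) (hLs : L.Coprime s) {k : ℕ} (B : Finset (Fin k → ℕ)) (lo hi : ℝ)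
    (tl : ℤ) (Y : ℝ) :
    ‖∑ m ∈ B, ∑ n ∈ apBox lo hi L tl, (if ((ν * ((∏ i, m i) * n) : ℕ) : ℝ) ≤ Y then
        uR Rd s ((((ν * ((∏ i, m i) * n)) : ℕ) : ZMod s) * ((c : ZMod s))⁻¹) else 0)‖ ≤
      |∑ m ∈ B, ∑ n ∈ apBox lo hi L tl,
        (if ((ν * ((∏ i, m i) * n) : ℕ) : ℝ) ≤ Y then gAP s (aRep s c ν) ((∏ i, m i) * n) else 0)| +
      Rd ^ 2 * (B.card : ℝ) * ((σ 0 s : ℝ) ^ 2 / (Nat.totient s : ℝ)) := by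
  rw [windowSum_uR_eq hRd hc hν B (apBox lo hi L tl) (fun m n => ((ν * ((∏ i, m i) * n) : ℕ) : ℝ) ≤ Y)]
  refine (norm_sub_le _ _).trans (add_le_add ?_ ?_)
  · rw [Complex.norm_real, Real.norm_eq_abs]
  · rw [norm_mul, norm_inv, Complex.norm_natCast]
    exact norm_charPart_total_le hL hLs B lo hi tl ν Y (by linarith) _

/-! ### The Type I bound -/

/-- **Type I bound for Drappeau's kernel against smooth variables** (Drappeau 2017 §6.2, third case of the
trichotomy, with Fouvry–Tenenbaum's Lemmas 4.12–4.13 as the divisor-function input `hFT`, constants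
`(δ, C₀, C)`).  Let `k + 1` smooth variables range over dyadic boxes `(Vᵢ, 2Vᵢ]`, `(Vl, 2Vl]` (scales increasing,
`Vl` the largest, all `≥ x_F^{1/100}`, product `≤ x_F`) in unit classes `mod L`, cut by the hyperbola
`ν (∏mᵢ) n ≤ Y`; let `𝒮` be a set of moduli `s ≤ x_F^θ` coprime to `cL`.  Then
`∑_{s ∈ 𝒮} |∑_{m⃗, n} 𝔲_{Rd}(ν (∏mᵢ) n c̄; s)| ≤ H^k C L^{C₀} x_F^{1−δ} Φ + (kY/(νH) + ∏ 2Vᵢ)(Dv + Φ)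
+ Rd² (∏ 2Vᵢ) Ψ`, `Φ = ∑_s 1/φ(s)`, `Ψ = ∑_s τ(s)²/φ(s)`, `Dv` a bound for `#{s ∈ 𝒮 : s ∣ z}`, `0 < |z| ≤ 2^{k+2} ν x_F`,
for every `H ≥ 1`, `Rd ≥ 1`. [cite: Drappeau2017, §6.2] -/
theorem typeI_uR_bound {k : ℕ} {θ δ C₀ C : ℝ}
    (hFT : ∀ x : ℝ, 1 ≤ x → ∀ (M lo hi : Fin k → ℝ) (Ml lol hil : ℝ), Monotone M → (∀ i, M i ≤ Ml) →
      (∀ i, x ^ (1 / 100 : ℝ) ≤ M i) → x ^ (1 / 100 : ℝ) ≤ Ml → (∏ i, M i) * Ml ≤ x →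
      (∀ i, M i ≤ lo i) → (∀ i, hi i ≤ 2 * M i) → Ml ≤ lol → hil ≤ 2 * Ml →
      ∀ (s D : ℕ) (a : ℤ) (t : Fin k → ℤ) (tl : ℤ), 1 ≤ s → (s : ℝ) ≤ x ^ θ → 1 ≤ D →
      IsCoprime (s : ℤ) (a * D) → (∀ i, IsCoprime (t i) (D : ℤ)) → IsCoprime tl (D : ℤ) →
      |∑ m ∈ piFinset (fun i => apBox (lo i) (hi i) D (t i)), ∑ n ∈ apBox lol hil D tl,
          gAP s a ((∏ i, m i) * n)| ≤ C * (D : ℝ) ^ C₀ * x ^ (1 - δ) / (Nat.totient s : ℝ))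
    (hC : 0 ≤ C) {xF : ℝ} (hxF : 1 ≤ xF) {V : Fin k → ℝ} (hVmono : Monotone V) {Vl : ℝ} (hVVl : ∀ i, V i ≤ Vl)
    (hV1 : ∀ i, xF ^ (1 / 100 : ℝ) ≤ V i) (hVl1 : xF ^ (1 / 100 : ℝ) ≤ Vl) (hprod : (∏ i, V i) * Vl ≤ xF)
    {L : ℕ} (hL : 1 ≤ L) {t : Fin k → ℤ} (ht : ∀ i, IsCoprime (t i) (L : ℤ)) {tl : ℤ}
    (htl : IsCoprime tl (L : ℤ)) {c : ℤ} (hcVl : (|c| : ℝ) ≤ Vl) {ν : ℕ} (hν : 1 ≤ ν) {Y : ℝ} (hY : 0 ≤ Y)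
    {H : ℕ} (hH : 1 ≤ H) {Rd : ℝ} (hRd : 1 ≤ Rd) (𝒮 : Finset ℕ)
    (h𝒮 : ∀ s ∈ 𝒮, 1 ≤ s ∧ s.Coprime L ∧ IsCoprime (s : ℤ) c ∧ (s : ℝ) ≤ xF ^ θ)
    {Dv : ℝ} (hDv : ∀ z : ℤ, z ≠ 0 → (|z| : ℝ) ≤ 2 ^ (k + 2) * ν * xF →
      ((𝒮.filter (fun s : ℕ => (s : ℤ) ∣ z)).card : ℝ) ≤ Dv) :
    ∑ s ∈ 𝒮, ‖∑ m ∈ piFinset (fun i => apBox (V i) (2 * V i) L (t i)), ∑ n ∈ apBox Vl (2 * Vl) L tl,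
        (if ((ν * ((∏ i, m i) * n) : ℕ) : ℝ) ≤ Y then
          uR Rd s ((((ν * ((∏ i, m i) * n)) : ℕ) : ZMod s) * ((c : ZMod s))⁻¹) else 0)‖ ≤
      (H : ℝ) ^ k * (C * (L : ℝ) ^ C₀ * xF ^ (1 - δ)) * ∑ s ∈ 𝒮, ((Nat.totient s : ℝ))⁻¹ +
        ((k : ℝ) * Y / (ν * H) + ∏ i, (2 * V i)) * (Dv + ∑ s ∈ 𝒮, ((Nat.totient s : ℝ))⁻¹) +
        Rd ^ 2 * (∏ i, (2 * V i)) * ∑ s ∈ 𝒮, (σ 0 s : ℝ) ^ 2 / (Nat.totient s : ℝ) := by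
  have hx100 : 1 ≤ xF ^ (1 / 100 : ℝ) := Real.one_le_rpow hxF (by norm_num)
  have hV1' : ∀ i, 1 ≤ V i := fun i => hx100.trans (hV1 i)
  have hL0 : 0 < L := hL
  have hBcard : ((piFinset (fun i => apBox (V i) (2 * V i) L (t i))).card : ℝ) ≤ ∏ i, (2 * V i) := by
    rw [Fintype.card_piFinset, Nat.cast_prod]
    exact Finset.prod_le_prod (fun i _ => Nat.cast_nonneg _) fun i _ => card_apBox_le (hV1' i) L (t i)
  have hprod0 : 0 ≤ ∏ i, (2 * V i) := Finset.prod_nonneg fun i _ => by linarith [hV1' i]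
  -- the coprime moduli
  have hsub : 𝒮.filter (fun s => ν.Coprime s) ⊆ 𝒮 := Finset.filter_subset _ _
  have h𝒮₁ : ∀ s ∈ 𝒮.filter (fun s => ν.Coprime s),
      1 ≤ s ∧ s.Coprime L ∧ IsCoprime (s : ℤ) c ∧ (s : ℝ) ≤ xF ^ θ ∧ ν.Coprime s := by
    intro s hs
    rw [Finset.mem_filter] at hs
    exact ⟨(h𝒮 s hs.1).1, (h𝒮 s hs.1).2.1, (h𝒮 s hs.1).2.2.1, (h𝒮 s hs.1).2.2.2, hs.2⟩
  -- the others vanish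
  rw [← Finset.sum_filter_add_sum_filter_not 𝒮 (fun s => ν.Coprime s)]
  rw [Finset.sum_eq_zero (s := 𝒮.filter (fun s => ¬ ν.Coprime s)) fun s hs => by
    rw [Finset.mem_filter] at hs
    rw [windowSum_uR_eq_zero hs.2, norm_zero], add_zero]
  -- the `g`-part on the coprime moduli
  have hg := sum_abs_gAPpart_le (θ := θ) hFT hxF hVmono hVVl hV1 hVl1 hprod hL ht htl hcVl hν hY hH
    (𝒮.filter (fun s => ν.Coprime s)) h𝒮₁ (Dv := Dv) (fun z hz hzle => le_trans (by
      exact_mod_cast Finset.card_le_card (Finset.filter_subset_filter _ hsub)) (hDv z hz hzle))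
  have hΦ₁ : ∑ s ∈ 𝒮.filter (fun s => ν.Coprime s), ((Nat.totient s : ℝ))⁻¹ ≤ ∑ s ∈ 𝒮, ((Nat.totient s : ℝ))⁻¹ :=
    Finset.sum_le_sum_of_subset_of_nonneg hsub fun _ _ _ => inv_nonneg.2 (Nat.cast_nonneg _)
  have hΨ₁ : ∑ s ∈ 𝒮.filter (fun s => ν.Coprime s), (σ 0 s : ℝ) ^ 2 / (Nat.totient s : ℝ) ≤
      ∑ s ∈ 𝒮, (σ 0 s : ℝ) ^ 2 / (Nat.totient s : ℝ) :=
    Finset.sum_le_sum_of_subset_of_nonneg hsub fun _ _ _ => by positivity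
  have hDv0 : 0 ≤ Dv := le_trans (Nat.cast_nonneg _) (hDv 1 one_ne_zero (by
    simp only [Int.cast_one, abs_one]
    have h2 : (1 : ℝ) ≤ 2 ^ (k + 2) := one_le_pow₀ (by norm_num)
    have h3 : (1 : ℝ) ≤ ν := by exact_mod_cast hν
    have h4 : (1 : ℝ) ≤ 2 ^ (k + 2) * ν := one_le_mul_of_one_le_of_one_le h2 h3
    nlinarith))
  have hcoef1 : 0 ≤ (H : ℝ) ^ k * (C * (L : ℝ) ^ C₀ * xF ^ (1 - δ)) := by positivity
  have hcoef2 : 0 ≤ (k : ℝ) * Y / (ν * H) + ∏ i, (2 * V i) := by positivity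
  -- per modulus
  have hper : ∀ s ∈ 𝒮.filter (fun s => ν.Coprime s),
      ‖∑ m ∈ piFinset (fun i => apBox (V i) (2 * V i) L (t i)), ∑ n ∈ apBox Vl (2 * Vl) L tl,
        (if ((ν * ((∏ i, m i) * n) : ℕ) : ℝ) ≤ Y then
          uR Rd s ((((ν * ((∏ i, m i) * n)) : ℕ) : ZMod s) * ((c : ZMod s))⁻¹) else 0)‖ ≤
      |∑ m ∈ piFinset (fun i => apBox (V i) (2 * V i) L (t i)), ∑ n ∈ apBox Vl (2 * Vl) L tl,
        (if ((ν * ((∏ i, m i) * n) : ℕ) : ℝ) ≤ Y then gAP s (aRep s c ν) ((∏ i, m i) * n) else 0)| +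
      Rd ^ 2 * (∏ i, (2 * V i)) * ((σ 0 s : ℝ) ^ 2 / (Nat.totient s : ℝ)) := by
    intro s hs
    obtain ⟨hs1, hsL, hsc, -, hsν⟩ := h𝒮₁ s hs
    haveI : NeZero s := ⟨by omega⟩
    refine (norm_windowSum_uR_le hRd hsc hsν hL0 hsL.symm _ Vl (2 * Vl) tl Y).trans (add_le_add le_rfl ?_)
    refine mul_le_mul_of_nonneg_right (mul_le_mul_of_nonneg_left hBcard (by positivity)) (by positivity)
  calc _ ≤ ∑ s ∈ 𝒮.filter (fun s => ν.Coprime s),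
        (|∑ m ∈ piFinset (fun i => apBox (V i) (2 * V i) L (t i)), ∑ n ∈ apBox Vl (2 * Vl) L tl,
          (if ((ν * ((∏ i, m i) * n) : ℕ) : ℝ) ≤ Y then gAP s (aRep s c ν) ((∏ i, m i) * n) else 0)| +
        Rd ^ 2 * (∏ i, (2 * V i)) * ((σ 0 s : ℝ) ^ 2 / (Nat.totient s : ℝ))) := Finset.sum_le_sum hper
    _ = ∑ s ∈ 𝒮.filter (fun s => ν.Coprime s),
          |∑ m ∈ piFinset (fun i => apBox (V i) (2 * V i) L (t i)), ∑ n ∈ apBox Vl (2 * Vl) L tl,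
            (if ((ν * ((∏ i, m i) * n) : ℕ) : ℝ) ≤ Y then gAP s (aRep s c ν) ((∏ i, m i) * n) else 0)| +
        Rd ^ 2 * (∏ i, (2 * V i)) *
          ∑ s ∈ 𝒮.filter (fun s => ν.Coprime s), (σ 0 s : ℝ) ^ 2 / (Nat.totient s : ℝ) := by
        rw [Finset.sum_add_distrib, Finset.mul_sum]
    _ ≤ ((H : ℝ) ^ k * (C * (L : ℝ) ^ C₀ * xF ^ (1 - δ)) *
            ∑ s ∈ 𝒮.filter (fun s => ν.Coprime s), ((Nat.totient s : ℝ))⁻¹ +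
          ((k : ℝ) * Y / (ν * H) + ∏ i, (2 * V i)) *
            (Dv + ∑ s ∈ 𝒮.filter (fun s => ν.Coprime s), ((Nat.totient s : ℝ))⁻¹)) +
        Rd ^ 2 * (∏ i, (2 * V i)) *
          ∑ s ∈ 𝒮.filter (fun s => ν.Coprime s), (σ 0 s : ℝ) ^ 2 / (Nat.totient s : ℝ) := by
        gcongr
    _ ≤ _ := by
        gcongr

/-- The same with the divisor-function input packaged as `DivisorAPTuple k θ`. [cite: Drappeau2017, §6.2] -/
theorem typeI_uR_bound_of_divisorAPTuple {k : ℕ} {θ : ℝ} (hFT : DivisorAPTuple k θ) :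
    ∃ δ C₀ C : ℝ, 0 < δ ∧ 0 ≤ C₀ ∧ 0 ≤ C ∧
    ∀ (xF : ℝ), 1 ≤ xF → ∀ (V : Fin k → ℝ), Monotone V → ∀ (Vl : ℝ), (∀ i, V i ≤ Vl) →
      (∀ i, xF ^ (1 / 100 : ℝ) ≤ V i) → xF ^ (1 / 100 : ℝ) ≤ Vl → (∏ i, V i) * Vl ≤ xF →
    ∀ (L : ℕ), 1 ≤ L → ∀ (t : Fin k → ℤ), (∀ i, IsCoprime (t i) (L : ℤ)) → ∀ (tl : ℤ), IsCoprime tl (L : ℤ) →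
    ∀ (c : ℤ), (|c| : ℝ) ≤ Vl → ∀ (ν : ℕ), 1 ≤ ν → ∀ (Y : ℝ), 0 ≤ Y → ∀ (H : ℕ), 1 ≤ H →
    ∀ (Rd : ℝ), 1 ≤ Rd →
    ∀ (𝒮 : Finset ℕ), (∀ s ∈ 𝒮, 1 ≤ s ∧ s.Coprime L ∧ IsCoprime (s : ℤ) c ∧ (s : ℝ) ≤ xF ^ θ) →
    ∀ (Dv : ℝ), (∀ z : ℤ, z ≠ 0 → (|z| : ℝ) ≤ 2 ^ (k + 2) * ν * xF →
      ((𝒮.filter (fun s : ℕ => (s : ℤ) ∣ z)).card : ℝ) ≤ Dv) →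
    ∑ s ∈ 𝒮, ‖∑ m ∈ piFinset (fun i => apBox (V i) (2 * V i) L (t i)), ∑ n ∈ apBox Vl (2 * Vl) L tl,
        (if ((ν * ((∏ i, m i) * n) : ℕ) : ℝ) ≤ Y then
          uR Rd s ((((ν * ((∏ i, m i) * n)) : ℕ) : ZMod s) * ((c : ZMod s))⁻¹) else 0)‖ ≤
      (H : ℝ) ^ k * (C * (L : ℝ) ^ C₀ * xF ^ (1 - δ)) * ∑ s ∈ 𝒮, ((Nat.totient s : ℝ))⁻¹ +
        ((k : ℝ) * Y / (ν * H) + ∏ i, (2 * V i)) * (Dv + ∑ s ∈ 𝒮, ((Nat.totient s : ℝ))⁻¹) +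
        Rd ^ 2 * (∏ i, (2 * V i)) * ∑ s ∈ 𝒮, (σ 0 s : ℝ) ^ 2 / (Nat.totient s : ℝ) := by
  obtain ⟨δ, C₀, C, hδ, hC₀, hC, hP⟩ := hFT
  refine ⟨δ, C₀, C, hδ, hC₀, hC, ?_⟩
  intro xF hxF V hVmono Vl hVVl hV1 hVl1 hprod L hL t ht tl htl c hcVl ν hν Y hY H hH Rd hRd 𝒮 h𝒮 Dv hDv
  exact typeI_uR_bound hP hC hxF hVmono hVVl hV1 hVl1 hprod hL ht htl hcVl hν hY hH hRd 𝒮 h𝒮 hDv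

end DrappeauTypeI

end Literature.NumberTheory.Sieve

end
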